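import Summits.Ventures.CertifiedManyBodySolver.Theorems.M3x2EdgeSplitSymReplayShardsB
import HarnessLib

/-!
# SymReplay — sharded replay, FAST per-call accessors (T12c; hub-lb-sym-eng-3)

`shardPolyAt K c j` (T12b) indexes into `shardPolys K c`, whose evaluation is STRICT: a compiled per-shard call would
materialise every shard's pair expansion.  This module adds accessors that compute ONLY shard `j`
(`shardPolyAtFast`: walk the blocks by chunk COUNTS, expand one chunk) and the shard count without the shards
(`shardCount`), proves them equal to the T12b objects (`shardPolyAtFast_eq`, `shardCount_eq`), and restates the
per-call facts / the assembly theorem in the fast form (`shardOKFast`, `ShardFactsFast`,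
`energyDensity_ge_of_shardsFast`) — the CLOSING GRAMMAR a multi-call literal should use.
No summit or crux statement is proved here; no certificate beyond toys is replayed; nothing here predicts superconductivity.
-/

noncomputable section

namespace Summit.Ventures.CertifiedManyBodySolver.Theorems.SymReplay

open Matrix Finset
open Literature.MathematicalPhysics.QuantumLattice
open Literature.MathematicalPhysics.QuantumLattice.HubbardWave0
open Literature.MathematicalPhysics.QuantumLattice.ThermodynamicLimit
open Literature.Probability.LatticeModels
open Literature.MathematicalPhysics.QuantumManyBody.StateRelaxation
open Summit.Ventures.CertifiedManyBodySolver.Theorems.WardSlot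
open scoped ComplexOrder BigOperators

/-- The row chunks of a block (spine only: no products). -/
def blockChunks (c : ℕ) (B : GramBlock) : List (List (QPoly × List (ℚ × ℕ))) :=
  chunksOf c (blockPairs B).length (blockPairs B)

/-- Shard `i` of a block, if any: `(−scale) •` the rows of its `i`-th chunk. -/
def blockShardAt (c : ℕ) (B : GramBlock) (i : ℕ) : Option QPoly :=
  ((blockChunks c B)[i]?).map fun ch => pscale (-B.scale) (blockRowsPoly B ch)

/-- The fast block-shard accessor agrees with indexing `blockShardPolys`. -/
theorem blockShardAt_eq (c : ℕ) (B : GramBlock) (i : ℕ) : blockShardAt c B i = (blockShardPolys c B)[i]? := by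
  rw [blockShardAt, blockShardPolys, List.getElem?_map]
  rfl

/-- A block has one shard per row chunk. -/
theorem length_blockShardPolys (c : ℕ) (B : GramBlock) : (blockShardPolys c B).length = (blockChunks c B).length := by
  rw [blockShardPolys, List.length_map]
  rfl

/-- Shard `i` among the block shards of a block list, computed by walking chunk COUNTS (only the target chunk is
expanded). -/
def shardsFrom (c : ℕ) : List GramBlock → ℕ → QPoly
  | [], _ => []
  | B :: rest, i =>
    if i < (blockChunks c B).length then (blockShardAt c B i).getD [] else shardsFrom c rest (i - (blockChunks c B).length)

/-- Walking by chunk counts agrees with indexing the concatenated block shards. -/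
theorem shardsFrom_eq (c : ℕ) : ∀ (Bs : List GramBlock) (i : ℕ),
    shardsFrom c Bs i = ((Bs.flatMap (blockShardPolys c))[i]?).getD []
  | [], i => by simp [shardsFrom]
  | B :: rest, i => by
    rw [shardsFrom, List.flatMap_cons]
    split_ifs with h
    · rw [List.getElem?_append_left (by rw [length_blockShardPolys]; exact h), blockShardAt_eq]
    · rw [List.getElem?_append_right (by rw [length_blockShardPolys]; omega), length_blockShardPolys,
        shardsFrom_eq c rest]

/-- **Shard `j`, computed alone** (base shard for `j = 0`, else walk the blocks). -/
def shardPolyAtFast (K : SymCert) (c : ℕ) : ℕ → QPoly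
  | 0 => baseShard K
  | j + 1 => shardsFrom c K.gramM j

/-- The fast accessor IS the T12b accessor. -/
theorem shardPolyAtFast_eq (K : SymCert) (c j : ℕ) : shardPolyAtFast K c j = shardPolyAt K c j := by
  cases j with
  | zero => rfl
  | succ j => rw [shardPolyAtFast, shardPolyAt, shardPolys, List.getElem?_cons_succ, shardsFrom_eq]

/-- **The number of shards, computed without the shards.** -/
def shardCount (K : SymCert) (c : ℕ) : ℕ := 1 + (K.gramM.map fun B => (blockChunks c B).length).sum

/-- The fast shard count IS the number of shards. -/
theorem shardCount_eq (K : SymCert) (c : ℕ) : shardCount K c = (shardPolys K c).length := by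
  rw [shardCount, shardPolys, List.length_cons, List.length_flatMap, Nat.add_comm]
  congr 2
  exact List.map_congr_left fun B _ => (length_blockShardPolys c B).symm

/-- **What ONE farm call proves about shard `j` — fast form** (only shard `j` is expanded). -/
def shardOKFast (K : SymCert) (c j : ℕ) (P : QPoly) : Bool :=
  psuppIn P K.frame && isZero (psub (canonNF K.frame (shardPolyAtFast K c j)) P)

/-- The fast per-call fact IS the T12b per-call fact. -/
theorem shardOKFast_eq (K : SymCert) (c j : ℕ) (P : QPoly) : shardOKFast K c j P = shardOK K c j P := by
  rw [shardOKFast, shardOK, shardPolyAtFast_eq]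

/-- The per-call facts in fast form (structural on the literal partial list). -/
def ShardFactsFast (K : SymCert) (c : ℕ) : ℕ → List QPoly → Prop
  | _, [] => True
  | j, P :: Ps => shardOKFast K c j P = true ∧ ShardFactsFast K c (j + 1) Ps

/-- Fast per-call facts give the T12b facts. -/
theorem shardFacts_of_fast (K : SymCert) (c : ℕ) : ∀ (Ps : List QPoly) (j : ℕ), ShardFactsFast K c j Ps → ShardFacts K c j Ps
  | [], _, _ => trivial
  | P :: Ps, j, h => ⟨(shardOKFast_eq K c j P) ▸ h.1, shardFacts_of_fast K c Ps (j + 1) h.2⟩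

/-- **SHARDED REPLAY, CLOSING FORM.**  A lander ships, per shard `j < shardCount K c`, ONE module with
`theorem shard_j : shardOKFast K c j P_j = true := by native_decide` (only shard `j` is expanded), then one file with
`hcount : shardCount K c = m + 1` (cheap call), `hfacts : ShardFactsFast K c 0 [P₀, …, P_m] := ⟨shard_0, …, shard_m, trivial⟩`,
`hfin : isZero (canonNF K.frame [P₀, …, P_m].flatten) = true` (one call) and `hwf : wellFormed K = true` (one cheap call),
and concludes `symValue K ≤ e₀(1,0,8,7/8)` by this theorem (or `NearCertWardSlack_*` through
`nearCertWardSlack_of_wardD4CertGe (wardD4CertGe_of_shardsFast …)`). -/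
theorem wardD4CertGe_of_shardsFast (K : SymCert) (hwf : wellFormed K = true) (c : ℕ) (Ps : List QPoly)
    (hcount : shardCount K c = Ps.length) (hfacts : ShardFactsFast K c 0 Ps)
    (hfin : isZero (canonNF K.frame Ps.flatten) = true) : WardD4CertGe ((symValue K : ℚ) : ℝ) :=
  wardD4CertGe_of_shards K hwf c Ps ((shardCount_eq K c).symm.trans hcount) (shardFacts_of_fast K c Ps 0 hfacts) hfin

/-- … and the energy-density bound. -/
theorem energyDensity_ge_of_shardsFast (K : SymCert) (hwf : wellFormed K = true) (c : ℕ) (Ps : List QPoly)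
    (hcount : shardCount K c = Ps.length) (hfacts : ShardFactsFast K c 0 Ps)
    (hfin : isZero (canonNF K.frame Ps.flatten) = true) :
    ((symValue K : ℚ) : ℝ) ≤ energyDensityTT' 1 0 8 (7 / 8) :=
  energyDensity_ge_of_windowSound_cert _ WardSlot.stub_wardWindowSound
    (wardD4CertGe_of_shardsFast K hwf c Ps hcount hfacts hfin)

/-- Kernel regression (toy): the fast count and the fast accessor on `toyCertM` at `c = 0`. -/
example : shardCount toyCertM 0 = 26 ∧
    isZero (psub (shardPolyAtFast toyCertM 0 3) (shardPolyAt toyCertM 0 3)) = true := by decide +kernel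

end Summit.Ventures.CertifiedManyBodySolver.Theorems.SymReplay

end
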